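import Summits.BirchSwinnertonDyer.BirchSwinnertonDyer.Theorems.PrintCf2InertOddHeegnerResidual
import Summits.BirchSwinnertonDyer.BirchSwinnertonDyer.Theorems.PrintCf2SplitBadTwoHalvesOfHeegnerIndexAtTwoByName
import Summits.BirchSwinnertonDyer.BirchSwinnertonDyer.Theorems.PrintCf2SplitBadTwoHalvesOfHeegnerIndexSmallConductor
import Summits.BirchSwinnertonDyer.Rank1Residual.Partition.CornersCM
import Literature.NumberTheory.EllipticCurves.ComplexMultiplicationHasCMThirteenProofs
import HarnessLib

/-!
# Crux `PrintCf2.InertOddHeegnerJOfFacts` (stmt-BirchSwinnertonDyer-20672) in the HEEGNER-INDEX CURRENCY at `2`: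
# the crux and both registered stubs of line `oddheegner-birth` (skeleton c7918dee93b5bc45) BY NAME from facts-relative index bounds
# on Heegner frames, and conversely the index EQUALITY on every frame from the crux — `--supports stmt-BirchSwinnertonDyer-20672`

Seat `leafhand-bsd-printcf2-2` g0 (prover, 2026-08-30; route `PrintCf2`, cell bus `pub/bsd-eis`). THEOREMS ONLY (0 definitions, 0 named
facts, 0 `sorry`); CONDITIONAL on every displayed hypothesis; closes no item and no stub. BSD is proved for no curve by any of this.

WHY. Crux 20672 is `BSD(W,2)` RELATIVE TO 𝔅_inert for every globally minimal `W/ℚ` of analytic rank one with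
`j(W) ∈ {−32768, −884736, −884736000, −147197952000, −262537412640768000}` (quadratic twists of `121b1`, `361a1`, `1849a1`, `4489a1`,
`26569a1`; CM by the maximal order of `ℚ(√−q)`, `q ∈ {11, 19, 43, 67, 163}`, `2` inert; `W(ℚ)[2] = 0`; `c_q = 2` on every twist). Its
birth skeleton cuts it by reduction at `2` (`stub_inertOddHeegner_goodAtTwo` / `…_badAtTwo`, both research: no print beyond
`N < 5000`, seat p4's `stubs_inertOddHeegner_iff_largeConductor_of_S31`). The line card names ONE lever one hypothesis away — a
Kolyvagin-system argument on Heegner frames over an auxiliary imaginary quadratic `K` (Heegner hypothesis for `N_W`, NOT the CM field)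
with the Tamagawa-`2` local condition at the CM prime made explicit (L8 / `CMKolyvaginAtInertTwo`'s machine, whose habitat excludes
this class only through «odd Tamagawa»). That lever, like every Heegner-point road, speaks the INDEX currency of the split-bad siblings
27850 / 27851 (`stub_heegnerIndexUpperAtTwo` / `stub_heegnerIndexLowerAtTwo`): on a Heegner frame `(N, K, Dt, H, ι, P)` with `d_K < −4`,
  UPPER («Kolyvagin»)   `ord₂ #Ш(E/K)[2^∞] + ord₂ c_K ≤ 2·ord₂ [E(K):ℤP] − 2·ord₂ c`,
  LOWER («Eisenstein»)  `2·ord₂ [E(K):ℤP] − 2·ord₂ c ≤ ord₂ #Ш(E/K)[2^∞] + ord₂ c_K`.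
This file is the socket: it states the two index bounds for the inert odd-Heegner class with the SAME displayed binders as the siblings'
registered stubs (𝔅_inert as antecedent; `L(E^{(d_K)},1) ≠ 0`, `r_an(E_K) = 1`, `P ↦ y_K`, `P` non-torsion, `rank E(K) = 1`, `Ш(E/K)` finite
displayed) and proves, GIVEN the cite-level prints `ToricPublishedInputs ∧ Milne 1972 §1 Thm 1 (any model)` exactly as on 27850 / 27851:
* §1 CM on the class (Silverman App. C §11 via `hasCM_of_j_eq_…`); the twin's `BSD₂` is the landed `rankZeroTwistBSDp_two_of_hasCM_of_print` (the twist `E^{(d_K)}` at a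
  Heegner field with `L(E^{(d_K)},1) ≠ 0` has CM and analytic rank `0`, so 𝔅_inert's `bsdTriple_of_hasCM_of_L_one_ne_zero` + modularity give
  `BSD₂` on any globally minimal model — `bsdp_cm_rankZero`);
* §2 ONE `W` of the class: bare UPPER + LOWER index bounds on its frames ⟹ `BSD(W,2)` (p638495's `missingUpperBoundAt_two_of_heegnerIndexBound_of_twist`
  / `missingLowerBoundAt_…` + Miller bookkeeping `bsdp_of_missingPPartAt`);
* §3 CLASS LEVEL, BY NAME: the crux `InertOddHeegnerJOfFacts` and each registered stub (types verbatim) from the prints + the two displayed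
  index stubs (displayed ⟹ bare by LEAD g8's `heegnerIndexUpperBound_of_displayed` / `…LowerBound_of_displayed`; crux ⟺ stubs by p4's
  `inertOddHeegnerJOfFacts_iff_stubs`);
* §4 CONVERSELY the crux gives the index EQUALITY on every Heegner frame of every class member (`KsideFiniteTwo.heegnerIndexEq_two_of_bsdp_of_twist`),
  so modulo the prints the index currency is EXACT for 20672 — nothing is lost by moving the research to the frames.
References: [GrossZagier1986] Thm. I.6.3, V.(2.2); [Kolyvagin1990] Thm. A (shape); [Milne1972ArithmeticAV] §1 Thm. 1; [Miller2011LMS] Def. 1.1;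
[SilvermanAEC2009] App. C §11; [KrizLi2019] Ex. 6.2 (why (★) is void here); [JetchevSkinnerWan2017] §7.4.1 (shape of the lower half).
-/

set_option autoImplicit false

-- D-0017 layout: summit = sub-problem, so `Summit.BirchSwinnertonDyer.BirchSwinnertonDyer.…` is the mandated namespace of Theorems files.
set_option linter.dupNamespace false

noncomputable section

open scoped Classical NumberField

namespace Summit.BirchSwinnertonDyer.BirchSwinnertonDyer.Theorems.PrintCf2.InertOddHeegnerIndexTwo

open WeierstrassCurve NumberField Literature.NumberTheory.EllipticCurves Literature.NumberTheory.EllipticCurves.ModularForms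
  Literature.NumberTheory.EllipticCurves.Rank1Residual Literature.NumberTheory.EllipticCurves.Rank1Residual.Typed
  Literature.NumberTheory.EllipticCurves.KrizLi2019 Literature.NumberTheory.EllipticCurves.ShuZhai2021
  Summit.BirchSwinnertonDyer.Rank1Residual Summit.BirchSwinnertonDyer.Rank1Residual.AdditivePotMult
  Summit.BirchSwinnertonDyer.BirchSwinnertonDyer.Theses.UniversalToricDescent
  Summit.BirchSwinnertonDyer.BirchSwinnertonDyer.Theorems.PrintCf2.EisensteinTwo
  Summit.BirchSwinnertonDyer.BirchSwinnertonDyer.Theorems.PrintCf2.KsideFiniteTwo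

/-! ### §1 CM on the class (the twin's `BSD₂` is the tree's `rankZeroTwistBSDp_two_of_hasCM_of_print`) -/

/-- **Every curve of the inert odd-Heegner class has CM** (the five `j` are among the thirteen rational CM `j`-invariants:
`D = −11, −19, −43, −67, −163`). [cite: SilvermanAEC2009, App. C §11, Examples 11.3.1–11.3.2] -/
theorem hasCM_of_inertOddHeegnerJ (W : WeierstrassCurve ℚ) [W.IsElliptic]
    (hj : (W.j = -32768 ∨ W.j = -884736 ∨ W.j = -884736000 ∨ W.j = -147197952000 ∨ W.j = -262537412640768000)) : W.HasCM := by
  rcases hj with hj | hj | hj | hj | hj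
  · exact WeierstrassCurve.hasCM_of_j_eq_neg32768 W hj
  · exact WeierstrassCurve.hasCM_of_j_eq_neg884736 W hj
  · exact WeierstrassCurve.hasCM_of_j_eq_neg884736000 W hj
  · exact WeierstrassCurve.hasCM_of_j_eq_neg147197952000 W hj
  · exact WeierstrassCurve.hasCM_of_j_eq_neg262537412640768000 W hj

-- The twin's `BSD₂` for a CM curve (`hTw` binder of p638495 / p641012) is the landed
-- `Summit.BirchSwinnertonDyer.BirchSwinnertonDyer.Theorems.PrintCf2.rankZeroTwistBSDp_two_of_hasCM_of_print` (p-file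
-- `PrintCf2SplitBadEisensteinTwoBdpComposition`), reused below by name.

/-! ### §2 ONE curve: both bare index bounds on its Heegner frames ⟹ `BSD(W,2)` -/

/-- **`BSD(W,2)` for ONE CM curve of analytic rank one from the two bare index bounds on its Heegner frames.** GIVEN the toric prints `hF`
(Gross–Zagier, Kolyvagin, GZK, modularity, Friedberg–Hoffstein, parity, Heegner points), Milne on minimal models, the CM rank-`0` fact `hBF`:
UPPER + LOWER index bounds on every Heegner frame of `W` with `d_K < −4`, `P` non-torsion, `rank E(K) = 1`, `Ш(E/K)` finite ⟹ `BSD(W,2)`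
(both Miller halves by p638495 §2, then `missingPPartAt_of_lower_of_upper` / `bsdp_of_missingPPartAt`). No conductor / reduction hypothesis.
[cite: Kolyvagin1990, Thm. A (shape)] [cite: GrossZagier1986, V.(2.2)] [cite: Milne1972ArithmeticAV, §1 Thm. 1] [cite: Miller2011LMS, Def. 1.1] -/
theorem bsdp_two_of_heegnerIndexBounds_of_hasCM (hF : ToricPublishedInputs) (hMilne : Milne1972.bsdQuotient_baseChange_quadratic)
    (hBF : bsdTriple_of_hasCM_of_L_one_ne_zero)
    (W : WeierstrassCurve ℚ) [W.IsElliptic] [W.IsGloballyMinimal] (hCM : W.HasCM) (hr : W.analyticRank = 1)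
    (hU : ∀ (N : ℕ) [NeZero N] (K : Type) [Field K] [NumberField K] (Dt : ModularParametrizationData W N)
        (H : HeegnerDatum N (NumberField.discr K)) (ι : K →+* ℂ) (P : (W.baseChange K).toAffine.Point),
        W.conductorNorm ℤ = N → IsImaginaryQuadratic K → SatisfiesHeegnerHypothesis N K → NumberField.discr K < -4 →
        WeierstrassCurve.Affine.Point.map ι.toRatAlgHom P = heegnerPointComplex Dt H → ¬ IsOfFinAddOrder P →
        (W.baseChange K).mordellWeilRank = 1 → Finite (W.baseChange K).sha →
        (padicValNat 2 (Nat.card (AddCommGroup.primaryComponent (W.baseChange K).sha 2)) : ℤ) +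
            (padicValNat 2 (W.baseChange K).tamagawaProduct : ℤ) ≤
          2 * (padicValNat 2 (AddSubgroup.zmultiples P).index : ℤ) - 2 * (padicValNat 2 Dt.c.natAbs : ℤ))
    (hL : ∀ (N : ℕ) [NeZero N] (K : Type) [Field K] [NumberField K] (Dt : ModularParametrizationData W N)
        (H : HeegnerDatum N (NumberField.discr K)) (ι : K →+* ℂ) (P : (W.baseChange K).toAffine.Point),
        W.conductorNorm ℤ = N → IsImaginaryQuadratic K → SatisfiesHeegnerHypothesis N K → NumberField.discr K < -4 →
        WeierstrassCurve.Affine.Point.map ι.toRatAlgHom P = heegnerPointComplex Dt H → ¬ IsOfFinAddOrder P →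
        (W.baseChange K).mordellWeilRank = 1 → Finite (W.baseChange K).sha →
        2 * (padicValNat 2 (AddSubgroup.zmultiples P).index : ℤ) - 2 * (padicValNat 2 Dt.c.natAbs : ℤ) ≤
          (padicValNat 2 (Nat.card (AddCommGroup.primaryComponent (W.baseChange K).sha 2)) : ℤ) +
            (padicValNat 2 (W.baseChange K).tamagawaProduct : ℤ)) :
    BSDp W 2 := by
  have hGZK : rank_eq_analyticRank_of_analyticRank_le_one := hF.2.2.1
  have hmod : hasEntireLFunction_rat := hF.2.2.2.1
  have hTw := rankZeroTwistBSDp_two_of_hasCM_of_print hBF hmod W hCM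
  have hup : MissingUpperBoundAt W 2 := missingUpperBoundAt_two_of_heegnerIndexBound_of_twist hF hMilne W hr hU hTw
  have hlo : MissingLowerBoundAt W 2 := missingLowerBoundAt_two_of_heegnerIndexBound_of_twist hF hMilne W hr hL hTw
  exact bsdp_of_missingPPartAt W 2 hGZK (by rw [hr]) (missingPPartAt_of_lower_of_upper W 2 hlo hup)

/-! ### §3 CLASS LEVEL, BY NAME: crux 20672 and its two registered stubs from the prints + the two DISPLAYED index stubs -/

/-- **Crux `PrintCf2.InertOddHeegnerJOfFacts` (item 20672) FROM the cite-level prints `hPr` (`ToricPublishedInputs` ∧ Milne 1972 §1 Thm. 1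
any-model — the siblings' `stub_prints_kside_two` verbatim) AND the two FACTS-RELATIVE INDEX STUBS of the inert odd-Heegner class** — `hU`
(«Kolyvagin direction») and `hL` («Eisenstein direction»), each with 𝔅_inert as antecedent and the DISPLAYED frame binders of
`stub_heegnerIndexUpperAtTwo` / `stub_heegnerIndexLowerAtTwo` (27850 / 27851) token for token. Displayed ⟹ bare by
`heegnerIndexUpperBound_of_displayed` / `heegnerIndexLowerBound_of_displayed`; CM by §1; then §2. CONDITIONAL on `hPr`, `hU`, `hL`; the research
content of 20672 is exactly `hU ∧ hL`. [cite: Kolyvagin1990, Thm. A (shape)] [cite: JetchevSkinnerWan2017, §7.4.1 (shape)]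
[cite: Milne1972ArithmeticAV, §1 Thm. 1] [cite: Miller2011LMS, Def. 1.1] -/
theorem inertOddHeegnerJOfFacts_of_heegnerIndexStubs
    (hPr : (ToricPublishedInputs ∧ Milne1972.bsdQuotient_baseChange_quadratic_anyModel))
    (hU : (Literature.NumberTheory.EllipticCurves.rank_eq_analyticRank_of_analyticRank_le_one ∧ WeierstrassCurve.hasEntireLFunction_rat ∧
        WeierstrassCurve.bsdRHS_eq_of_isIsogenous ∧ Literature.NumberTheory.EllipticCurves.bsdTriple_of_hasCM_of_L_one_ne_zero ∧
        Literature.NumberTheory.EllipticCurves.KrizLi2019.thm112_bsdTwo_twist ∧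
        Literature.NumberTheory.EllipticCurves.ShuZhai2021.thm12_ranks_of_twists ∧
        Literature.NumberTheory.EllipticCurves.ShuZhai2021.thm14_twoPartBSD_of_twists ∧
        Literature.NumberTheory.EllipticCurves.ShuZhai2021.thm410_twoAdicValuations_of_twists) →
    ∀ (W : WeierstrassCurve ℚ) [W.IsElliptic] [W.IsGloballyMinimal], W.analyticRank = 1 →
      (W.j = -32768 ∨ W.j = -884736 ∨ W.j = -884736000 ∨ W.j = -147197952000 ∨ W.j = -262537412640768000) →
      ∀ (N : ℕ) [NeZero N] (K : Type) [Field K] [NumberField K] (Dt : ModularParametrizationData W N)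
        (H : HeegnerDatum N (NumberField.discr K)) (ι : K →+* ℂ) (P : (W.baseChange K).toAffine.Point),
        W.conductorNorm ℤ = N → IsImaginaryQuadratic K → SatisfiesHeegnerHypothesis N K → NumberField.discr K < -4 →
        (W.quadraticTwist (NumberField.discr K : ℚ)).entireLFunction 1 ≠ 0 → (W.baseChange K).analyticRank = 1 →
        WeierstrassCurve.Affine.Point.map ι.toRatAlgHom P = heegnerPointComplex Dt H → ¬ IsOfFinAddOrder P →
        (W.baseChange K).mordellWeilRank = 1 → Finite (W.baseChange K).sha →
        (padicValNat 2 (Nat.card (AddCommGroup.primaryComponent (W.baseChange K).sha 2)) : ℤ) +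
            (padicValNat 2 (W.baseChange K).tamagawaProduct : ℤ) ≤
          2 * (padicValNat 2 (AddSubgroup.zmultiples P).index : ℤ) - 2 * (padicValNat 2 Dt.c.natAbs : ℤ))
    (hL : (Literature.NumberTheory.EllipticCurves.rank_eq_analyticRank_of_analyticRank_le_one ∧ WeierstrassCurve.hasEntireLFunction_rat ∧
        WeierstrassCurve.bsdRHS_eq_of_isIsogenous ∧ Literature.NumberTheory.EllipticCurves.bsdTriple_of_hasCM_of_L_one_ne_zero ∧
        Literature.NumberTheory.EllipticCurves.KrizLi2019.thm112_bsdTwo_twist ∧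
        Literature.NumberTheory.EllipticCurves.ShuZhai2021.thm12_ranks_of_twists ∧
        Literature.NumberTheory.EllipticCurves.ShuZhai2021.thm14_twoPartBSD_of_twists ∧
        Literature.NumberTheory.EllipticCurves.ShuZhai2021.thm410_twoAdicValuations_of_twists) →
    ∀ (W : WeierstrassCurve ℚ) [W.IsElliptic] [W.IsGloballyMinimal], W.analyticRank = 1 →
      (W.j = -32768 ∨ W.j = -884736 ∨ W.j = -884736000 ∨ W.j = -147197952000 ∨ W.j = -262537412640768000) →
      ∀ (N : ℕ) [NeZero N] (K : Type) [Field K] [NumberField K] (Dt : ModularParametrizationData W N)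
        (H : HeegnerDatum N (NumberField.discr K)) (ι : K →+* ℂ) (P : (W.baseChange K).toAffine.Point),
        W.conductorNorm ℤ = N → IsImaginaryQuadratic K → SatisfiesHeegnerHypothesis N K → NumberField.discr K < -4 →
        (W.quadraticTwist (NumberField.discr K : ℚ)).entireLFunction 1 ≠ 0 → (W.baseChange K).analyticRank = 1 →
        WeierstrassCurve.Affine.Point.map ι.toRatAlgHom P = heegnerPointComplex Dt H → ¬ IsOfFinAddOrder P →
        (W.baseChange K).mordellWeilRank = 1 → Finite (W.baseChange K).sha →
        2 * (padicValNat 2 (AddSubgroup.zmultiples P).index : ℤ) - 2 * (padicValNat 2 Dt.c.natAbs : ℤ) ≤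
          (padicValNat 2 (Nat.card (AddCommGroup.primaryComponent (W.baseChange K).sha 2)) : ℤ) +
            (padicValNat 2 (W.baseChange K).tamagawaProduct : ℤ)) :
    Summit.BirchSwinnertonDyer.BirchSwinnertonDyer.Theses.PrintCf2.InertOddHeegnerJOfFacts := by
  unfold Summit.BirchSwinnertonDyer.BirchSwinnertonDyer.Theses.PrintCf2.InertOddHeegnerJOfFacts
  intro hB W _ _ hr hj
  have hCM : W.HasCM := hasCM_of_inertOddHeegnerJ W hj
  exact bsdp_two_of_heegnerIndexBounds_of_hasCM hPr.1 (Milne1972.bsdQuotient_baseChange_quadratic_of_anyModel hPr.2) hB.2.2.2.1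
    W hCM hr (heegnerIndexUpperBound_of_displayed hPr.1 W hr (hU hB W hr hj))
    (heegnerIndexLowerBound_of_displayed hPr.1 W hr (hL hB W hr hj))

/-- **Registered stub `stub_inertOddHeegner_goodAtTwo` (type VERBATIM, skeleton c7918dee93b5bc45) from the prints + the two index stubs**
(through the crux and p4's `inertOddHeegnerJOfFacts_iff_stubs`). [cite: Miller2011LMS, Def. 1.1] -/
theorem stub_inertOddHeegner_goodAtTwo_of_heegnerIndexStubs
    (hPr : (ToricPublishedInputs ∧ Milne1972.bsdQuotient_baseChange_quadratic_anyModel))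
    (hU : (Literature.NumberTheory.EllipticCurves.rank_eq_analyticRank_of_analyticRank_le_one ∧ WeierstrassCurve.hasEntireLFunction_rat ∧
        WeierstrassCurve.bsdRHS_eq_of_isIsogenous ∧ Literature.NumberTheory.EllipticCurves.bsdTriple_of_hasCM_of_L_one_ne_zero ∧
        Literature.NumberTheory.EllipticCurves.KrizLi2019.thm112_bsdTwo_twist ∧
        Literature.NumberTheory.EllipticCurves.ShuZhai2021.thm12_ranks_of_twists ∧
        Literature.NumberTheory.EllipticCurves.ShuZhai2021.thm14_twoPartBSD_of_twists ∧
        Literature.NumberTheory.EllipticCurves.ShuZhai2021.thm410_twoAdicValuations_of_twists) →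
    ∀ (W : WeierstrassCurve ℚ) [W.IsElliptic] [W.IsGloballyMinimal], W.analyticRank = 1 →
      (W.j = -32768 ∨ W.j = -884736 ∨ W.j = -884736000 ∨ W.j = -147197952000 ∨ W.j = -262537412640768000) →
      ∀ (N : ℕ) [NeZero N] (K : Type) [Field K] [NumberField K] (Dt : ModularParametrizationData W N)
        (H : HeegnerDatum N (NumberField.discr K)) (ι : K →+* ℂ) (P : (W.baseChange K).toAffine.Point),
        W.conductorNorm ℤ = N → IsImaginaryQuadratic K → SatisfiesHeegnerHypothesis N K → NumberField.discr K < -4 →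
        (W.quadraticTwist (NumberField.discr K : ℚ)).entireLFunction 1 ≠ 0 → (W.baseChange K).analyticRank = 1 →
        WeierstrassCurve.Affine.Point.map ι.toRatAlgHom P = heegnerPointComplex Dt H → ¬ IsOfFinAddOrder P →
        (W.baseChange K).mordellWeilRank = 1 → Finite (W.baseChange K).sha →
        (padicValNat 2 (Nat.card (AddCommGroup.primaryComponent (W.baseChange K).sha 2)) : ℤ) +
            (padicValNat 2 (W.baseChange K).tamagawaProduct : ℤ) ≤
          2 * (padicValNat 2 (AddSubgroup.zmultiples P).index : ℤ) - 2 * (padicValNat 2 Dt.c.natAbs : ℤ))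
    (hL : (Literature.NumberTheory.EllipticCurves.rank_eq_analyticRank_of_analyticRank_le_one ∧ WeierstrassCurve.hasEntireLFunction_rat ∧
        WeierstrassCurve.bsdRHS_eq_of_isIsogenous ∧ Literature.NumberTheory.EllipticCurves.bsdTriple_of_hasCM_of_L_one_ne_zero ∧
        Literature.NumberTheory.EllipticCurves.KrizLi2019.thm112_bsdTwo_twist ∧
        Literature.NumberTheory.EllipticCurves.ShuZhai2021.thm12_ranks_of_twists ∧
        Literature.NumberTheory.EllipticCurves.ShuZhai2021.thm14_twoPartBSD_of_twists ∧
        Literature.NumberTheory.EllipticCurves.ShuZhai2021.thm410_twoAdicValuations_of_twists) →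
    ∀ (W : WeierstrassCurve ℚ) [W.IsElliptic] [W.IsGloballyMinimal], W.analyticRank = 1 →
      (W.j = -32768 ∨ W.j = -884736 ∨ W.j = -884736000 ∨ W.j = -147197952000 ∨ W.j = -262537412640768000) →
      ∀ (N : ℕ) [NeZero N] (K : Type) [Field K] [NumberField K] (Dt : ModularParametrizationData W N)
        (H : HeegnerDatum N (NumberField.discr K)) (ι : K →+* ℂ) (P : (W.baseChange K).toAffine.Point),
        W.conductorNorm ℤ = N → IsImaginaryQuadratic K → SatisfiesHeegnerHypothesis N K → NumberField.discr K < -4 →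
        (W.quadraticTwist (NumberField.discr K : ℚ)).entireLFunction 1 ≠ 0 → (W.baseChange K).analyticRank = 1 →
        WeierstrassCurve.Affine.Point.map ι.toRatAlgHom P = heegnerPointComplex Dt H → ¬ IsOfFinAddOrder P →
        (W.baseChange K).mordellWeilRank = 1 → Finite (W.baseChange K).sha →
        2 * (padicValNat 2 (AddSubgroup.zmultiples P).index : ℤ) - 2 * (padicValNat 2 Dt.c.natAbs : ℤ) ≤
          (padicValNat 2 (Nat.card (AddCommGroup.primaryComponent (W.baseChange K).sha 2)) : ℤ) +
            (padicValNat 2 (W.baseChange K).tamagawaProduct : ℤ)) :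
    (Literature.NumberTheory.EllipticCurves.rank_eq_analyticRank_of_analyticRank_le_one ∧ WeierstrassCurve.hasEntireLFunction_rat ∧
        WeierstrassCurve.bsdRHS_eq_of_isIsogenous ∧ Literature.NumberTheory.EllipticCurves.bsdTriple_of_hasCM_of_L_one_ne_zero ∧
        Literature.NumberTheory.EllipticCurves.KrizLi2019.thm112_bsdTwo_twist ∧
        Literature.NumberTheory.EllipticCurves.ShuZhai2021.thm12_ranks_of_twists ∧
        Literature.NumberTheory.EllipticCurves.ShuZhai2021.thm14_twoPartBSD_of_twists ∧
        Literature.NumberTheory.EllipticCurves.ShuZhai2021.thm410_twoAdicValuations_of_twists) → ∀ (W : WeierstrassCurve ℚ) [W.IsElliptic] [W.IsGloballyMinimal], W.analyticRank = 1 →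
      (W.j = -32768 ∨ W.j = -884736 ∨ W.j = -884736000 ∨ W.j = -147197952000 ∨ W.j = -262537412640768000) → Literature.NumberTheory.EllipticCurves.Rank1Residual.Good W 2 → BSDp W 2 :=
  (Summit.BirchSwinnertonDyer.PrintCf2.inertOddHeegnerJOfFacts_iff_stubs.mp
    (inertOddHeegnerJOfFacts_of_heegnerIndexStubs hPr hU hL)).1

/-- **Registered stub `stub_inertOddHeegner_badAtTwo` (type VERBATIM, skeleton c7918dee93b5bc45) from the prints + the two index stubs**
(through the crux and p4's `inertOddHeegnerJOfFacts_iff_stubs`). [cite: Miller2011LMS, Def. 1.1] -/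
theorem stub_inertOddHeegner_badAtTwo_of_heegnerIndexStubs
    (hPr : (ToricPublishedInputs ∧ Milne1972.bsdQuotient_baseChange_quadratic_anyModel))
    (hU : (Literature.NumberTheory.EllipticCurves.rank_eq_analyticRank_of_analyticRank_le_one ∧ WeierstrassCurve.hasEntireLFunction_rat ∧
        WeierstrassCurve.bsdRHS_eq_of_isIsogenous ∧ Literature.NumberTheory.EllipticCurves.bsdTriple_of_hasCM_of_L_one_ne_zero ∧
        Literature.NumberTheory.EllipticCurves.KrizLi2019.thm112_bsdTwo_twist ∧
        Literature.NumberTheory.EllipticCurves.ShuZhai2021.thm12_ranks_of_twists ∧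
        Literature.NumberTheory.EllipticCurves.ShuZhai2021.thm14_twoPartBSD_of_twists ∧
        Literature.NumberTheory.EllipticCurves.ShuZhai2021.thm410_twoAdicValuations_of_twists) →
    ∀ (W : WeierstrassCurve ℚ) [W.IsElliptic] [W.IsGloballyMinimal], W.analyticRank = 1 →
      (W.j = -32768 ∨ W.j = -884736 ∨ W.j = -884736000 ∨ W.j = -147197952000 ∨ W.j = -262537412640768000) →
      ∀ (N : ℕ) [NeZero N] (K : Type) [Field K] [NumberField K] (Dt : ModularParametrizationData W N)
        (H : HeegnerDatum N (NumberField.discr K)) (ι : K →+* ℂ) (P : (W.baseChange K).toAffine.Point),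
        W.conductorNorm ℤ = N → IsImaginaryQuadratic K → SatisfiesHeegnerHypothesis N K → NumberField.discr K < -4 →
        (W.quadraticTwist (NumberField.discr K : ℚ)).entireLFunction 1 ≠ 0 → (W.baseChange K).analyticRank = 1 →
        WeierstrassCurve.Affine.Point.map ι.toRatAlgHom P = heegnerPointComplex Dt H → ¬ IsOfFinAddOrder P →
        (W.baseChange K).mordellWeilRank = 1 → Finite (W.baseChange K).sha →
        (padicValNat 2 (Nat.card (AddCommGroup.primaryComponent (W.baseChange K).sha 2)) : ℤ) +
            (padicValNat 2 (W.baseChange K).tamagawaProduct : ℤ) ≤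
          2 * (padicValNat 2 (AddSubgroup.zmultiples P).index : ℤ) - 2 * (padicValNat 2 Dt.c.natAbs : ℤ))
    (hL : (Literature.NumberTheory.EllipticCurves.rank_eq_analyticRank_of_analyticRank_le_one ∧ WeierstrassCurve.hasEntireLFunction_rat ∧
        WeierstrassCurve.bsdRHS_eq_of_isIsogenous ∧ Literature.NumberTheory.EllipticCurves.bsdTriple_of_hasCM_of_L_one_ne_zero ∧
        Literature.NumberTheory.EllipticCurves.KrizLi2019.thm112_bsdTwo_twist ∧
        Literature.NumberTheory.EllipticCurves.ShuZhai2021.thm12_ranks_of_twists ∧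
        Literature.NumberTheory.EllipticCurves.ShuZhai2021.thm14_twoPartBSD_of_twists ∧
        Literature.NumberTheory.EllipticCurves.ShuZhai2021.thm410_twoAdicValuations_of_twists) →
    ∀ (W : WeierstrassCurve ℚ) [W.IsElliptic] [W.IsGloballyMinimal], W.analyticRank = 1 →
      (W.j = -32768 ∨ W.j = -884736 ∨ W.j = -884736000 ∨ W.j = -147197952000 ∨ W.j = -262537412640768000) →
      ∀ (N : ℕ) [NeZero N] (K : Type) [Field K] [NumberField K] (Dt : ModularParametrizationData W N)
        (H : HeegnerDatum N (NumberField.discr K)) (ι : K →+* ℂ) (P : (W.baseChange K).toAffine.Point),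
        W.conductorNorm ℤ = N → IsImaginaryQuadratic K → SatisfiesHeegnerHypothesis N K → NumberField.discr K < -4 →
        (W.quadraticTwist (NumberField.discr K : ℚ)).entireLFunction 1 ≠ 0 → (W.baseChange K).analyticRank = 1 →
        WeierstrassCurve.Affine.Point.map ι.toRatAlgHom P = heegnerPointComplex Dt H → ¬ IsOfFinAddOrder P →
        (W.baseChange K).mordellWeilRank = 1 → Finite (W.baseChange K).sha →
        2 * (padicValNat 2 (AddSubgroup.zmultiples P).index : ℤ) - 2 * (padicValNat 2 Dt.c.natAbs : ℤ) ≤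
          (padicValNat 2 (Nat.card (AddCommGroup.primaryComponent (W.baseChange K).sha 2)) : ℤ) +
            (padicValNat 2 (W.baseChange K).tamagawaProduct : ℤ)) :
    (Literature.NumberTheory.EllipticCurves.rank_eq_analyticRank_of_analyticRank_le_one ∧ WeierstrassCurve.hasEntireLFunction_rat ∧
        WeierstrassCurve.bsdRHS_eq_of_isIsogenous ∧ Literature.NumberTheory.EllipticCurves.bsdTriple_of_hasCM_of_L_one_ne_zero ∧
        Literature.NumberTheory.EllipticCurves.KrizLi2019.thm112_bsdTwo_twist ∧
        Literature.NumberTheory.EllipticCurves.ShuZhai2021.thm12_ranks_of_twists ∧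
        Literature.NumberTheory.EllipticCurves.ShuZhai2021.thm14_twoPartBSD_of_twists ∧
        Literature.NumberTheory.EllipticCurves.ShuZhai2021.thm410_twoAdicValuations_of_twists) → ∀ (W : WeierstrassCurve ℚ) [W.IsElliptic] [W.IsGloballyMinimal], W.analyticRank = 1 →
      (W.j = -32768 ∨ W.j = -884736 ∨ W.j = -884736000 ∨ W.j = -147197952000 ∨ W.j = -262537412640768000) → ¬ Literature.NumberTheory.EllipticCurves.Rank1Residual.Good W 2 → BSDp W 2 :=
  (Summit.BirchSwinnertonDyer.PrintCf2.inertOddHeegnerJOfFacts_iff_stubs.mp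
    (inertOddHeegnerJOfFacts_of_heegnerIndexStubs hPr hU hL)).2

/-! ### §4 CONVERSELY: the crux gives the index EQUALITY on every Heegner frame of the class (the currency is exact modulo prints) -/

/-- **Crux 20672 ⟹ `ord₂ #Ш(E/K)[2^∞] + ord₂ c_K = 2·ord₂ [E(K):ℤP] − 2·ord₂ c` on every Heegner frame (`d_K < −4`, `P` non-torsion) of every
class member**, GIVEN the prints: `BSD(W,2)` from the crux, the twin's `BSD₂` from §1, then `KsideFiniteTwo.heegnerIndexEq_two_of_bsdp_of_twist`
(Gross–Zagier value + Milne (★)). So §3's two index stubs are not stronger than the crux: modulo `hPr` they are its two halves.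
[cite: GrossZagier1986, Thm. I.6.3 and V.(2.2)] [cite: Milne1972ArithmeticAV, §1 Thm. 1] [cite: Miller2011LMS, Def. 1.1] -/
theorem heegnerIndexEq_two_of_inertOddHeegnerJOfFacts
    (hPr : (ToricPublishedInputs ∧ Milne1972.bsdQuotient_baseChange_quadratic_anyModel))
    (h : Summit.BirchSwinnertonDyer.BirchSwinnertonDyer.Theses.PrintCf2.InertOddHeegnerJOfFacts) :
    (Literature.NumberTheory.EllipticCurves.rank_eq_analyticRank_of_analyticRank_le_one ∧ WeierstrassCurve.hasEntireLFunction_rat ∧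
        WeierstrassCurve.bsdRHS_eq_of_isIsogenous ∧ Literature.NumberTheory.EllipticCurves.bsdTriple_of_hasCM_of_L_one_ne_zero ∧
        Literature.NumberTheory.EllipticCurves.KrizLi2019.thm112_bsdTwo_twist ∧
        Literature.NumberTheory.EllipticCurves.ShuZhai2021.thm12_ranks_of_twists ∧
        Literature.NumberTheory.EllipticCurves.ShuZhai2021.thm14_twoPartBSD_of_twists ∧
        Literature.NumberTheory.EllipticCurves.ShuZhai2021.thm410_twoAdicValuations_of_twists) →
    ∀ (W : WeierstrassCurve ℚ) [W.IsElliptic] [W.IsGloballyMinimal], W.analyticRank = 1 →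
      (W.j = -32768 ∨ W.j = -884736 ∨ W.j = -884736000 ∨ W.j = -147197952000 ∨ W.j = -262537412640768000) →
      ∀ (N : ℕ) [NeZero N] (K : Type) [Field K] [NumberField K] (Dt : ModularParametrizationData W N)
        (H : HeegnerDatum N (NumberField.discr K)) (ι : K →+* ℂ) (P : (W.baseChange K).toAffine.Point),
        W.conductorNorm ℤ = N → IsImaginaryQuadratic K → SatisfiesHeegnerHypothesis N K → NumberField.discr K < -4 →
        WeierstrassCurve.Affine.Point.map ι.toRatAlgHom P = heegnerPointComplex Dt H → ¬ IsOfFinAddOrder P →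
        (padicValNat 2 (Nat.card (AddCommGroup.primaryComponent (W.baseChange K).sha 2)) : ℤ) +
            (padicValNat 2 (W.baseChange K).tamagawaProduct : ℤ) =
          2 * (padicValNat 2 (AddSubgroup.zmultiples P).index : ℤ) - 2 * (padicValNat 2 Dt.c.natAbs : ℤ) := by
  intro hB W _ _ hr hj N _ K _ _ Dt H ι P hN hK hHN hd4 hP hnt
  have hW2 : BSDp W 2 := by
    unfold Summit.BirchSwinnertonDyer.BirchSwinnertonDyer.Theses.PrintCf2.InertOddHeegnerJOfFacts at h
    exact h hB W hr hj
  have hCM : W.HasCM := hasCM_of_inertOddHeegnerJ W hj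
  exact heegnerIndexEq_two_of_bsdp_of_twist hPr.1 (Milne1972.bsdQuotient_baseChange_quadratic_of_anyModel hPr.2) W hr hW2
    (rankZeroTwistBSDp_two_of_hasCM_of_print hB.2.2.2.1 hB.2.1 W hCM) N K Dt H ι P hN hK hHN hd4 hP hnt

end Summit.BirchSwinnertonDyer.BirchSwinnertonDyer.Theorems.PrintCf2.InertOddHeegnerIndexTwo

end
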